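import Mathlib
import Literature.MathematicalPhysics.QuantumFieldTheory.Balaban1983to89.Beta.Drift

/-!
# CRIT-2 g2 — ROUND 2b probe (idea-8 `nesting-inheritance-tensor-power`, price P3⁸: consumer typing)

`WindowDrift` (idea-8's (Q1) output, verbatim from `NestingInheritanceSketch.lean` :35) is STRICTLY WEAKER than the tree's two-sided
`Beta.Drift.OneLoopDrift` consumed by line 1″'s concluders: (A) `OneLoopDrift b A β0 → WindowDrift b (2A) β0`; (B) the converse fails
(`β0 ≡ b + 1` has window drift with slope `b`, defect `0`, but no two-sided drift with slope `b`). So a line fed by idea-8 must conclude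
through a one-sided consumer (`WeakestBetaCurrency.Quarters`, socket (Q1)) or prove one-sided sufficiency of the an4 concluder. [folklore]
-/

namespace Summit.QuantumFields.YangMills.Cruxes.EndpointGivenBR13SepCoPH.Crit2Round2b

open Finset
open Literature.MathematicalPhysics.QuantumFieldTheory.Balaban1983to89.Beta.Drift (OneLoopDrift)

/-- verbatim from the idea-8 sketch (:35). -/
def WindowDrift (d A : ℝ) (β0 : ℕ → ℝ) : Prop :=
  ∀ k n : ℕ, k ≤ n → d * ((n : ℝ) - k) - A ≤ ∑ j ∈ Finset.Ico k n, β0 j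

/-- (A) two-sided cumulative drift ⟹ one-sided windowed drift with doubled defect. [folklore] -/
theorem windowDrift_of_oneLoopDrift {b A : ℝ} {β0 : ℕ → ℝ} (h : OneLoopDrift b A β0) : WindowDrift b (2 * A) β0 := by
  intro k n hkn
  have hk := h k
  have hn := h n
  rw [Finset.sum_Ico_eq_sub _ hkn]
  have h1 := (abs_le.mp hk).2
  have h2 := (abs_le.mp hn).1
  have : (b * ((n : ℝ) - k)) = b * n - b * k := by ring
  rw [this]
  linarith

/-- (B) the converse fails: `β0 ≡ b + 1` satisfies `WindowDrift b 0` … [folklore] -/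
theorem windowDrift_const_succ (b : ℝ) : WindowDrift b 0 (fun _ => b + 1) := by
  intro k n hkn
  simp only [Finset.sum_const, Nat.card_Ico, nsmul_eq_mul, sub_zero]
  rw [Nat.cast_sub hkn]
  have : (0 : ℝ) ≤ (n : ℝ) - k := by
    have : (k : ℝ) ≤ n := by exact_mod_cast hkn
    linarith
  nlinarith

/-- … but NO two-sided drift with slope `b` (any defect `A`): the partial sums run away from `b·k` linearly. [folklore] -/
theorem not_oneLoopDrift_const_succ (b A : ℝ) : ¬ OneLoopDrift b A (fun _ => b + 1) := by
  intro h
  have hA : 0 ≤ A := h.nonneg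
  -- take k = ⌈A⌉₊ + 1: the partial sum is (b+1)k, deviation k > A
  have hk := h (⌈A⌉₊ + 1)
  simp only [Finset.sum_const, Finset.card_range, nsmul_eq_mul] at hk
  have hcalc : ((⌈A⌉₊ + 1 : ℕ) : ℝ) * (b + 1) - b * ((⌈A⌉₊ + 1 : ℕ) : ℝ) = ((⌈A⌉₊ + 1 : ℕ) : ℝ) := by ring
  rw [hcalc] at hk
  have hge : (A : ℝ) < ((⌈A⌉₊ + 1 : ℕ) : ℝ) := by
    push_cast
    have := Nat.le_ceil A
    linarith
  have habs : |((⌈A⌉₊ + 1 : ℕ) : ℝ)| = ((⌈A⌉₊ + 1 : ℕ) : ℝ) := abs_of_nonneg (by positivity)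
  rw [habs] at hk
  linarith

/-- (B) packaged: one-sided windowed drift does NOT imply two-sided drift (same slope, any defect). [folklore] -/
theorem windowDrift_not_imp_oneLoopDrift :
    ¬ (∀ (b A : ℝ) (β0 : ℕ → ℝ), WindowDrift b A β0 → ∃ A', OneLoopDrift b A' β0) := by
  intro h
  obtain ⟨A', hA'⟩ := h 0 0 (fun _ => (0 : ℝ) + 1) (windowDrift_const_succ 0)
  exact not_oneLoopDrift_const_succ 0 A' hA'

end Summit.QuantumFields.YangMills.Cruxes.EndpointGivenBR13SepCoPH.Crit2Round2b
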